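import Literature.AnabelianGeometry.SemiGraphs.MetabelianLeafStarQuasiCoherent
import Literature.AnabelianGeometry.SemiGraphs.TemperedEstrangedElevatedConstructors
import Mathlib.Data.ZMod.QuotientGroup
import HarnessLib

/-!
# The elevation levels and approximator of `𝒢⋆(p)` («RAYLESS-STAR·CIV-NEG», brick S4, part 4a)

Mochizuki, *Semi-graphs of anabelioids*, Publ. RIMS **42** (2006), Def. 2.4 (i) p. 25 ("elevated": for
every `M` a `π₁`-epimorphic approximator and a subgroup `N_M` of the approximating vertex group of order `≥ M`
meeting every conjugate of every branch image trivially), Thm. 3.7 p. 40 [cite: MochizukiSemiAnbd2006, Def 2.4(i) p.25].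

Construction file (abc-iut cell, layer L3, row «RAYLESS-STAR·CIV-NEG», seat abc-iut-L3-t8 gen 6; desk memo §6),
preparing (H6) "totally elevated" for the rayless counter-carrier `𝒢⋆(p) = metabelianLeafStar p`: at the index
`e` the ELEVATION LEVELS — CENTRE `ab⁻¹(p^e ℤ_p²)` (with `b^k` in it iff `p^e ∣ k`, commutators in it, and the
abelianised branch lines `v = p^m u` meeting the axis `u = 0` only at `0`), EDGE `p^e ℤ_p`, LEAF
`ker(Leaf n → P_e × ℤ_p/p^e ℤ_p)` — and the `π₁`-epimorphic APPROXIMATOR `leafStarElevApproximator p e = (Π_v/U_e(v))`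
they define (abc-iut-w4-d075's `isQuasiCoherent_of_compatibleLevels` construction, named, with its class /
kernel / range lemmas).  The elevation itself is `MetabelianLeafStarElevated.lean`.
No named fact; no side taken on [IUTchIII] Cor 3.12.
-/

noncomputable section

open scoped Pointwise
open Topology Multiplicative

namespace Literature.AnabelianGeometry.SemiGraphs

open IwahoriWitness

universe u

variable {p : ℕ} [hp : Fact p.Prime]

/-! ### Two generic lemmas -/

/-- `p^e ∣ k` in `ℤ_p` iff in `ℕ`. [cite: RibesZalesskii2010, §4.1] -/
theorem PadicIntLevels.pow_dvd_natCast_iff (e k : ℕ) : (p : ℤ_[p]) ^ e ∣ (k : ℤ_[p]) ↔ p ^ e ∣ k := by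
  rw [← Ideal.mem_span_singleton, ← PadicInt.norm_le_pow_iff_mem_span_pow, ← Int.cast_natCast,
    PadicInt.norm_int_le_pow_iff_dvd]
  exact_mod_cast Iff.rfl

/-- If `N ≤ K` with `K` normal and `R ⊓ K = ⊥`, then `N` meets every conjugate of `R` trivially.
[cite: MochizukiSemiAnbd2006, Def 2.4(i) p.25] -/
theorem Subgroup.inf_map_conj_eq_bot_of_le_normal {G : Type*} [Group G] {N K R : Subgroup G} [K.Normal]
    (hNK : N ≤ K) (hRK : R ⊓ K = ⊥) (g : G) : N ⊓ R.map (MulAut.conj g).toMonoidHom = ⊥ := by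
  rw [eq_bot_iff]
  rintro x ⟨hxN, ⟨y, hyR, rfl⟩⟩
  rw [Subgroup.mem_bot]
  have hyK : y ∈ K := by
    have h := hNK hxN
    have h' : g⁻¹ * (g * y * g⁻¹) * g⁻¹⁻¹ ∈ K := ‹K.Normal›.conj_mem _ h g⁻¹
    simpa [mul_assoc] using h'
  have hy1 : y = 1 := by
    rw [← Subgroup.mem_bot, ← hRK]; exact ⟨hyR, hyK⟩
  rw [hy1]
  simp

/-! ### The elevation levels (index `e`) -/

namespace FreeProPRankTwo

variable (p)

/-- The elevation edge level `p^e ℤ_p = α⁻¹(ab⁻¹(p^e ℤ_p²))`. [cite: MochizukiSemiAnbd2006, Def 2.4(i) p.25] -/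
def elevEdgeLevel (e : ℕ) : Subgroup (Multiplicative ℤ_[p]) := (abLevel p e).comap (α p).toMonoidHom

/-- Membership in the elevation edge level: `p^e ∣ t`. [cite: MochizukiSemiAnbd2006, Def 2.4(i) p.25] -/
theorem mem_elevEdgeLevel_iff (e : ℕ) (t : Multiplicative ℤ_[p]) :
    t ∈ elevEdgeLevel p e ↔ (p : ℤ_[p]) ^ e ∣ t.toAdd := by
  rw [elevEdgeLevel, Subgroup.mem_comap, mem_abLevel_iff]
  have h' : (ab p) ((α p).toMonoidHom t) = ab p (α p t) := rfl
  rw [h', ab_α, toAdd_ofAdd]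
  simp

/-- The elevation edge level is open. [cite: MochizukiSemiAnbd2006, Def 2.4(i) p.25] -/
theorem isOpen_elevEdgeLevel (e : ℕ) : IsOpen (elevEdgeLevel p e : Set (Multiplicative ℤ_[p])) :=
  (isOpen_abLevel p e).preimage (α p).continuous

/-- Every centre gluing `θα p n` pulls `ab⁻¹(p^e ℤ_p²)` back to the elevation edge level (`θₙ`-stability).
[cite: MochizukiSemiAnbd2006, Def 2.4(i) p.25] -/
theorem comap_θα_abLevel (e n : ℕ) : (abLevel p e).comap (θα p n).toMonoidHom = elevEdgeLevel p e := by
  have h : (θα p n).toMonoidHom = (θHom p n).toMonoidHom.comp (α p).toMonoidHom := rfl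
  rw [h, ← Subgroup.comap_comap, comap_θ_abLevel]
  rfl

/-- `ab⁻¹(p^e ℤ_p²)` has finite index (open in a compact group). [cite: MochizukiSemiAnbd2006, Def 2.4(i) p.25] -/
theorem abLevel_index_ne_zero (e : ℕ) : (abLevel p e).index ≠ 0 := by
  haveI := Subgroup.quotient_finite_of_isOpen _ (isOpen_abLevel p e)
  exact Subgroup.index_ne_zero_of_finite

/-- `b^k ∈ ab⁻¹(p^e ℤ_p²) ↔ p^e ∣ k`. [cite: MochizukiSemiAnbd2006, Def 2.4(i) p.25] -/
theorem b_pow_mem_abLevel_iff (e k : ℕ) : b p ^ k ∈ abLevel p e ↔ p ^ e ∣ k := by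
  rw [mem_abLevel_iff, map_pow, ab_b, toAdd_pow, toAdd_ofAdd, Prod.smul_mk, smul_zero, nsmul_eq_mul, mul_one]
  simp only [dvd_zero, true_and]
  exact PadicIntLevels.pow_dvd_natCast_iff e k

/-- Commutators lie in `ab⁻¹(p^e ℤ_p²)` (the abelianisation is commutative).
[cite: MochizukiSemiAnbd2006, Def 2.4(i) p.25] -/
theorem inv_mul_inv_mul_mem_abLevel (e : ℕ) (x y : Grp p) : (x * y)⁻¹ * (y * x) ∈ abLevel p e := by
  rw [mem_abLevel_iff]
  have h1 : ab p ((x * y)⁻¹ * (y * x)) = 1 := by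
    rw [map_mul, map_inv, map_mul, map_mul, mul_comm (ab p y) (ab p x), inv_mul_cancel]
  rw [h1, toAdd_one]
  exact ⟨dvd_zero _, dvd_zero _⟩

/-- An element of a centre branch group `⟨a·b^{p^m}⟩‾` congruent to a power of `b` modulo `ab⁻¹(p^e ℤ_p²)` is
congruent to `1`: the abelianisation of `⟨a·b^{p^m}⟩‾` is the line `v = p^m u`, which meets the axis `u = 0`
only at `0` modulo `p^e`. [cite: MochizukiSemiAnbd2006, Def 2.4(i) p.25] -/
theorem b_pow_mem_abLevel_of_mem_An (e m k : ℕ) {x : Grp p} (hx : x ∈ An p m)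
    (h : (b p ^ k)⁻¹ * x ∈ abLevel p e) : b p ^ k ∈ abLevel p e := by
  have hline := FreeProPTwo.toAdd_map_snd_eq_mul_fst_of_mem_topologicalClosure_zpowers (ab p).toMonoidHom
    (ab p).continuous (c := a p * b p ^ p ^ m) (d := (p : ℤ_[p]) ^ m)
    (by
      change (ab p (a p * b p ^ p ^ m)).toAdd = _
      rw [map_mul, map_pow, ab_a, ab_b, toAdd_mul, toAdd_pow, toAdd_ofAdd, toAdd_ofAdd]
      simp) hx
  change ((ab p x).toAdd).2 = (p : ℤ_[p]) ^ m * ((ab p x).toAdd).1 at hline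
  rw [mem_abLevel_iff] at h ⊢
  have hab : (ab p ((b p ^ k)⁻¹ * x)).toAdd = (ab p x).toAdd - (0, (k : ℤ_[p])) := by
    rw [map_mul, map_inv, map_pow, ab_b, toAdd_mul, toAdd_inv, toAdd_pow, toAdd_ofAdd]
    simp [sub_eq_neg_add]
  rw [hab] at h
  obtain ⟨h1, h2⟩ := h
  simp only [Prod.fst_sub, sub_zero, Prod.snd_sub] at h1 h2
  rw [map_pow, ab_b, toAdd_pow, toAdd_ofAdd, Prod.smul_mk, smul_zero, nsmul_eq_mul, mul_one]
  refine ⟨dvd_zero _, ?_⟩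
  have h3 : (p : ℤ_[p]) ^ e ∣ ((ab p x).toAdd).2 := by rw [hline]; exact h1.mul_left _
  have h4 := dvd_sub h3 h2
  simpa using h4

end FreeProPRankTwo

/-! ### Total elevation of `𝒢⋆(p)` -/

namespace ProfiniteSemiGraph

variable (p)

/-- The centre of `𝒢⋆(p)` as a vertex (reducible name, so that statements about it type-check syntactically).
[cite: MochizukiSemiAnbd2006, §1 p.11] -/
abbrev leafStarCentre : (metabelianLeafStar p).graph.Vertex := (none : Option ℕ)

/-- The leaf `n` of `𝒢⋆(p)` as a vertex. [cite: MochizukiSemiAnbd2006, §1 p.11] -/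
abbrev leafStarLeaf (n : ℕ) : (metabelianLeafStar p).graph.Vertex := (some n : Option ℕ)

/-- The elevation levels of `𝒢⋆(p)` at index `e`: `ab⁻¹(p^e ℤ_p²)` at the centre, `ker(Leaf n → P_e × ℤ_p/p^eℤ_p)`
at the leaf `n`. [cite: MochizukiSemiAnbd2006, Def 2.4(i) p.25] -/
def leafStarElevLevel (e : ℕ) : ∀ v : (metabelianLeafStar p).graph.Vertex, Subgroup ((metabelianLeafStar p).Gv v)
  | none => FreeProPRankTwo.abLevel p e
  | some n => Iw.leafLevel (FreeProPRankTwo.elevEdgeLevel p e) n e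

/-- The elevation levels are normal. [cite: MochizukiSemiAnbd2006, Def 2.4(i) p.25] -/
theorem leafStarElevLevel_normal (e : ℕ) (v : (metabelianLeafStar p).graph.Vertex) :
    (leafStarElevLevel p e v).Normal := by
  cases v with
  | none => exact FreeProPRankTwo.abLevel_normal p e
  | some n => exact Iw.leafLevel_normal _ n e

/-- The elevation levels are open. [cite: MochizukiSemiAnbd2006, Def 2.4(i) p.25] -/
theorem isOpen_leafStarElevLevel (e : ℕ) (v : (metabelianLeafStar p).graph.Vertex) :
    IsOpen (leafStarElevLevel p e v : Set ((metabelianLeafStar p).Gv v)) := by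
  cases v with
  | none => exact FreeProPRankTwo.isOpen_abLevel p e
  | some n => exact Iw.isOpen_leafLevel _ (FreeProPRankTwo.isOpen_elevEdgeLevel p e) n e

/-- The elevation levels have finite index. [cite: MochizukiSemiAnbd2006, Def 2.3(i) p.24] -/
theorem leafStarElevLevel_finiteIndex (e : ℕ) (v : (metabelianLeafStar p).graph.Vertex) :
    (leafStarElevLevel p e v).FiniteIndex := by
  cases v with
  | none => exact ⟨FreeProPRankTwo.abLevel_index_ne_zero p e⟩
  | some n => exact ⟨(Iw.leafLevel_index_le _ (FreeProPRankTwo.isOpen_elevEdgeLevel p e) n e).1⟩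

/-- The elevation levels have index dividing one common positive number.
[cite: MochizukiSemiAnbd2006, Def 2.3(i) p.24] -/
theorem leafStarElevLevel_index (e : ℕ) :
    ∃ B : ℕ, 0 < B ∧ ∀ v, (leafStarElevLevel p e v).index ∣ B := by
  set K : ℕ := Nat.card (IwMod p e × (Multiplicative ℤ_[p] ⧸ FreeProPRankTwo.elevEdgeLevel p e)) with hK
  refine ⟨(FreeProPRankTwo.abLevel p e).index * K.factorial,
    Nat.mul_pos (Nat.pos_of_ne_zero (FreeProPRankTwo.abLevel_index_ne_zero p e)) (Nat.factorial_pos K), ?_⟩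
  rintro (_ | n)
  · exact Dvd.intro _ rfl
  · obtain ⟨h0, hle⟩ := Iw.leafLevel_index_le _ (FreeProPRankTwo.isOpen_elevEdgeLevel p e) n e
    exact (Nat.dvd_factorial (Nat.pos_of_ne_zero h0) hle).mul_left _

/-- The elevation edge level is normal. [cite: MochizukiSemiAnbd2006, Def 2.3(i) p.24] -/
theorem elevEdgeLevel_normal (e : ℕ) : (FreeProPRankTwo.elevEdgeLevel p e).Normal := inferInstance

/-- The elevation edge level has finite index. [cite: MochizukiSemiAnbd2006, Def 2.3(i) p.24] -/
theorem elevEdgeLevel_finiteIndex (e : ℕ) : (FreeProPRankTwo.elevEdgeLevel p e).FiniteIndex := by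
  haveI : CompactSpace (Multiplicative ℤ_[p]) := inferInstanceAs (CompactSpace ℤ_[p])
  haveI := Subgroup.quotient_finite_of_isOpen _ (FreeProPRankTwo.isOpen_elevEdgeLevel p e)
  exact ⟨Subgroup.index_ne_zero_of_finite⟩

-- Local (file-scoped, `Prop`-valued) instances: normality / finite index of OUR OWN level subgroups, so that
-- the quotients `Π_v / U_e(v)` below carry their group structure; they override no library instance.
attribute [local instance] leafStarElevLevel_normal leafStarElevLevel_finiteIndex elevEdgeLevel_normal
  elevEdgeLevel_finiteIndex

/-- Compatibility: every gluing pulls the elevation levels back to `p^e ℤ_p`. [cite: MochizukiSemiAnbd2006, Def 2.4(i) p.25] -/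
theorem comap_brHom_leafStarElevLevel (e : ℕ) (b : (metabelianLeafStar p).graph.Branch)
    (v : (metabelianLeafStar p).graph.Vertex) (h : (metabelianLeafStar p).graph.abuts b = some v) :
    (leafStarElevLevel p e v).comap ((metabelianLeafStar p).brHom b v h).toMonoidHom =
      FreeProPRankTwo.elevEdgeLevel p e := by
  obtain ⟨n, c⟩ := b
  have hv : SemiGraph.leafStarVertexOf (n, c) = v := Option.some.inj h
  subst hv
  cases c
  · exact Iw.comap_lowHom_leafLevel _ (fun t ht => (FreeProPRankTwo.mem_elevEdgeLevel_iff p e t).1 ht) n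
  · exact FreeProPRankTwo.comap_θα_abLevel p e n

/-- The induced branch map is well defined: the edge level lies in the pull-back of the vertex level.
[cite: MochizukiSemiAnbd2006, Def 2.3(ii) p.25] -/
theorem elevEdgeLevel_le_comap (e : ℕ) (b : (metabelianLeafStar p).graph.Branch)
    (v : (metabelianLeafStar p).graph.Vertex) (h : (metabelianLeafStar p).graph.abuts b = some v) :
    (FreeProPRankTwo.elevEdgeLevel p e :
        Subgroup ((metabelianLeafStar p).Ge ((metabelianLeafStar p).graph.edgeOf b))) ≤
      (leafStarElevLevel p e v).comap ((metabelianLeafStar p).brHom b v h).toMonoidHom :=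
  (comap_brHom_leafStarElevLevel p e b v h).ge

/-- The edge level lies in the kernel of `(quotient map) ∘ (gluing)`. [cite: MochizukiSemiAnbd2006, Def 2.3(ii) p.25] -/
theorem elevEdgeLevel_le_ker (e : ℕ) (b : (metabelianLeafStar p).graph.Branch)
    (v : (metabelianLeafStar p).graph.Vertex) (h : (metabelianLeafStar p).graph.abuts b = some v) :
    FreeProPRankTwo.elevEdgeLevel p e ≤
      ((QuotientGroup.mk' (leafStarElevLevel p e v)).comp ((metabelianLeafStar p).brHom b v h).toMonoidHom).ker :=
  fun _ ht => (QuotientGroup.eq_one_iff _).2 (elevEdgeLevel_le_comap p e b v h ht)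

/-- **The elevation approximator** `Π_v / U_e(v)`, `Π_e / p^e ℤ_p` with the induced branch maps (the
construction of abc-iut-w4-d075's `isQuasiCoherent_of_compatibleLevels`, named). [cite: MochizukiSemiAnbd2006, Def 2.3(ii) p.25] -/
def leafStarElevApproximator (e : ℕ) : (metabelianLeafStar p).Approximator where
  FV v := (metabelianLeafStar p).Gv v ⧸ leafStarElevLevel p e v
  FE _ := Multiplicative ℤ_[p] ⧸ FreeProPRankTwo.elevEdgeLevel p e
  πV v := QuotientGroup.mk' (leafStarElevLevel p e v)
  πE _ := QuotientGroup.mk' (FreeProPRankTwo.elevEdgeLevel p e)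
  isOpen_ker_πV v := by rw [QuotientGroup.ker_mk']; exact isOpen_leafStarElevLevel p e v
  isOpen_ker_πE _ := by
    show IsOpen (((QuotientGroup.mk' (FreeProPRankTwo.elevEdgeLevel p e)).ker :
      Subgroup (Multiplicative ℤ_[p])) : Set (Multiplicative ℤ_[p]))
    rw [QuotientGroup.ker_mk']; exact FreeProPRankTwo.isOpen_elevEdgeLevel p e
  brF b v h := QuotientGroup.lift (FreeProPRankTwo.elevEdgeLevel p e)
    ((QuotientGroup.mk' (leafStarElevLevel p e v)).comp ((metabelianLeafStar p).brHom b v h).toMonoidHom)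
    (elevEdgeLevel_le_ker p e b v h)
  brF_injective b v h := by
    rw [injective_iff_map_eq_one]
    intro x hx
    obtain ⟨t, rfl⟩ := QuotientGroup.mk_surjective x
    rw [QuotientGroup.lift_mk, MonoidHom.comp_apply, QuotientGroup.mk'_apply, QuotientGroup.eq_one_iff] at hx
    rw [QuotientGroup.eq_one_iff, ← comap_brHom_leafStarElevLevel p e b v h]
    exact hx
  comm b v h := ⟨1, fun x => by
    rw [one_mul, inv_one, mul_one]
    exact QuotientGroup.lift_mk (N := FreeProPRankTwo.elevEdgeLevel p e) (nN := elevEdgeLevel_normal p e)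
      (elevEdgeLevel_le_ker p e b v h) x⟩
  bounded := by
    obtain ⟨B, hB, hUB⟩ := leafStarElevLevel_index p e
    exact ⟨B, hB, fun v => by rw [← Subgroup.index_eq_card]; exact hUB v⟩

/-- The vertex maps of the elevation approximator are the quotient maps. [cite: MochizukiSemiAnbd2006, Def 2.3(ii) p.25] -/
theorem leafStarElevApproximator_πV (e : ℕ) (v : (metabelianLeafStar p).graph.Vertex) :
    (leafStarElevApproximator p e).πV v = QuotientGroup.mk' (leafStarElevLevel p e v) := rfl

/-- The branch maps of the elevation approximator on classes. [cite: MochizukiSemiAnbd2006, Def 2.3(ii) p.25] -/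
theorem leafStarElevApproximator_brF_mk (e : ℕ) (b : (metabelianLeafStar p).graph.Branch)
    (v : (metabelianLeafStar p).graph.Vertex) (h : (metabelianLeafStar p).graph.abuts b = some v)
    (x : (metabelianLeafStar p).Ge ((metabelianLeafStar p).graph.edgeOf b)) :
    (leafStarElevApproximator p e).brF b v h ((leafStarElevApproximator p e).πE _ x) =
      (leafStarElevApproximator p e).πV v ((metabelianLeafStar p).brHom b v h x) :=
  QuotientGroup.lift_mk (N := FreeProPRankTwo.elevEdgeLevel p e) (nN := elevEdgeLevel_normal p e)
    (elevEdgeLevel_le_ker p e b v h) x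

/-- The elevation approximator is `π₁`-epimorphic. [cite: MochizukiSemiAnbd2006, Def 2.3(ii) p.25] -/
theorem leafStarElevApproximator_isPiOneEpimorphic (e : ℕ) : (leafStarElevApproximator p e).IsPiOneEpimorphic :=
  ⟨fun v => QuotientGroup.mk'_surjective (leafStarElevLevel p e v), fun _ => QuotientGroup.mk_surjective⟩

/-- `πV v x = 1 ↔ x ∈ U_e(v)`. [cite: MochizukiSemiAnbd2006, Def 2.3(ii) p.25] -/
theorem leafStarElevApproximator_πV_eq_one_iff (e : ℕ) (v : (metabelianLeafStar p).graph.Vertex)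
    (x : (metabelianLeafStar p).Gv v) :
    (leafStarElevApproximator p e).πV v x = 1 ↔ x ∈ leafStarElevLevel p e v :=
  QuotientGroup.eq_one_iff x

/-- `πV v x = πV v y ↔ x⁻¹ y ∈ U_e(v)`. [cite: MochizukiSemiAnbd2006, Def 2.3(ii) p.25] -/
theorem leafStarElevApproximator_πV_eq_iff (e : ℕ) (v : (metabelianLeafStar p).graph.Vertex)
    (x y : (metabelianLeafStar p).Gv v) :
    (leafStarElevApproximator p e).πV v x = (leafStarElevApproximator p e).πV v y ↔
      x⁻¹ * y ∈ leafStarElevLevel p e v :=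
  QuotientGroup.eq

/-- The range of a branch map of the elevation approximator is the image of the branch subgroup.
[cite: MochizukiSemiAnbd2006, Def 2.3(ii) p.25] -/
theorem leafStarElevApproximator_range_brF (e : ℕ) (b : (metabelianLeafStar p).graph.Branch)
    (v : (metabelianLeafStar p).graph.Vertex) (h : (metabelianLeafStar p).graph.abuts b = some v) :
    ((leafStarElevApproximator p e).brF b v h).range =
      ((metabelianLeafStar p).branchSubgroup b v h).map ((leafStarElevApproximator p e).πV v) := by
  ext z
  constructor
  · rintro ⟨q, rfl⟩
    obtain ⟨x, rfl⟩ := QuotientGroup.mk_surjective q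
    exact ⟨(metabelianLeafStar p).brHom b v h x, ⟨x, rfl⟩, (leafStarElevApproximator_brF_mk p e b v h x).symm⟩
  · rintro ⟨_, ⟨x, rfl⟩, rfl⟩
    exact ⟨(leafStarElevApproximator p e).πE _ x, leafStarElevApproximator_brF_mk p e b v h x⟩

end ProfiniteSemiGraph

end Literature.AnabelianGeometry.SemiGraphs

end
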